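import Summits.QuantumFields.BalabanUV.Beta.D1BFx.NeedleNdlDipColLetters

/-!
# `BalabanUV.Beta.D1BFx.NeedleNdlDipByParts` — road «BF-x» for binder row D1, slot (K), END row `hGrp gN`, «GN-33 ∕ NK+KN» LETTERS (by parts): THE TWO
# DIPOLE PAIRINGS THAT NEED THE LATTICE DIFFERENCE MOVED OFF `δρ_b` — `⟨Φ, ∇f⟩ = −⟨D⁻Φ, f⟩` for a bounded `Φ` whose backward unit differences carry a
# NEEDLE-WEIGHTED damped profile of exponent 2 (`Φ = Ga∇row_u`: `S4(δρ)`) or a flat SUP (`Φ = Ga∇C_u`: `S2(δρ)`), against a dipole value profile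
# `|f| ≤ Bδ·e∕nrm(x−b)³` — generic in `Φ` and `f`, n-powers explicit

HONEST DEPENDENCY (cell records, verbatim): «continuum YM on T⁴ ⇐ BetaPertH ∧ nine spine estimates (0/9 proved); BetaPertH ⇐ (D1) ∧ (D4) ∧
CAP+tail; G-an2-4 gates asym, D1 and NE2/3/4.»  HONEST FRAMING (cell contract, verbatim): «discharging `BetaPertH` makes Bałaban's UV stability
UNCONDITIONAL — a real constructive-QFT result; it is NOT the continuum limit and NOT the Clay problem.»  THIS MODULE DISCHARGES NOTHING of the
wall: [folklore] lattice bookkeeping over leaf-04-g9's `PairingByParts.pairing_grad_eq` ∕ `profile_shift_le` ∕ `supNorm_unitVec_le` and the HLS kit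
(`LatticeHLSDamped.abs_sum_mul_le_of_damped_profiles`, `LatticeHLSProfiles.sum_pow_mul_exp_div_nrm_pow_free_scale_le` ∕ `summable_and_abs_tsum_le_of_abs_sum_le`,
`NeedleHLSGain.abs_pairing_le_of_needle_left`).  GENERIC: no leg, no needle, no printed statement appears — the profile hypotheses are fed later
(`NeedleNdlProjLetters.exists_applyK_grad_row_le`, `GluonLocalNdlLetters.exists_applyK_grad_row_diff_le` ∕ `exists_applyK_gradC_diff_le`,
`NeedleColumnLetters.exists_applyK_gradC_le`, `NeedleDipDipLetters.exists_functionLetters`, all modulo [B5, Prop. 1.2] ∧ [B5, (1.126)–(1.127)] BY NAME).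
No `def`, no `def … : Prop`, nothing cited, 0 sorry.  Root-level binders hW ∕ hR-sockets ∕ hSX-socket ∕ D1Tel ∕ D1Rep — 0 discharged; (K) NOT closed;
NOT D1, NOT `BetaPertH`, NOT continuum, NOT Clay.

ABSOLUTE RULE (cell charter, verbatim): «No internally-minted statement may enter as a cited fact. Every hypothesis is either kernel-proved in
this package or a verbatim quotation of a PUBLISHED theorem with page reference. The manuscript(s) under audit are NOT citable for their own
disputed steps — they are the thing under adjudication; programme-internal (2001/route/tribunal) claims are never citable.»

WHY (owner d1-p2 gen 11 RULING ρ-g11-2 ∕ ρ-g11-3; my statement line l.31599).  In the `ndl ⊗ dip` word the pairings `S4(δρ_b) = ⟨Ga∇row_u, ∇δρ_b⟩` and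
`S2(δρ_b) = ⟨Ga∇C_u, ∇δρ_b⟩` read directly are one power of `n` short (`Ga∇row_u` is an exponent-1 profile: against `∇δρ_b ~ n⁻²e∕nrm³` the pair (1,3)
is critical ⇒ `n⁻³`; `Ga∇C_u ~ n` against `‖∇δρ_b‖₁ ~ n⁻¹` ⇒ `n⁰`).  Moving the difference onto `Φ` (`pairing_grad_eq`; two summabilities from
`|f| ∈ ℓ¹`, `Φ` bounded) replaces `Φ` by its unit differences: `D⁻(Ga∇row_u)` is the exponent-2 needle profile `kΦ′∕n²` (the pair (2,3) is NOT
critical: n-free HLS constant, gain `1∕nrm(s−b)`) ⇒ `S4(δρ) ~ n⁻⁴·Σ_s|q|·e∕nrm(s−b)`; `D⁻(Ga∇C_u)` is the flat sup `kN′·c₁ ~ n⁰` ⇒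
`S2(δρ) ≤ 4kN′c₁·‖δρ_b‖₁ ~ n⁻¹`.
* §1 [folklore] `summable_dip_mul_bdd` (a damped cubic profile times a bounded factor is absolutely summable, with the `ℓ¹` bound `Bδ·c_ℓ·n`).
* §2 [folklore] **`abs_pairing_grad_dip_le_of_needle_d1`** (needle-weighted exponent-2 backward differences; for `S4(δρ)`).
* §3 [folklore] **`abs_pairing_grad_dip_le_of_flat_d1`** (flat sup of the differences; for `S2(δρ)`).
NOT HERE (honest): the instantiation at `Ga∇row_u` ∕ `Ga∇C_u` ∕ `δρ_b` (the word file), the other fourteen pairings (`NeedleNdlDipRowLetters`,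
`NeedleNdlDipColLetters`), the census.
Unit `b2b-balaban-beta-d1-formalise-leaf-01` (gen 15), D1 formalisation swarm LEAF PROVER 01; `LEAVES-BFx.md` row (N) «GN-33∕NK+KN» letters 3.
-/

noncomputable section

namespace Summit.QuantumFields.BalabanUV.Beta.D1BFx.NeedleNdlDipByParts

open Finset
open scoped BigOperators
open Literature.MathematicalPhysics.QuantumFieldTheory.Balaban1983to89
open Literature.MathematicalPhysics.QuantumFieldTheory.Balaban1983to89.Beta
open ExpKernelCalculus (Site MKer)
open Beta.PoissonInterior (nrm nrm_pos nrm_neg)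
open AffineAveraging (unitVec)
open Summit.QuantumFields.BalabanUV.Beta.D1BFx.RankOneBubble (pairing applyK pairing_comm pairing_def)
open Summit.QuantumFields.BalabanUV.Beta.D1BFx.RankOneBubbleJets (grad grad_apply)
open Summit.QuantumFields.BalabanUV.Beta.D1BFx.LatticeHLSDamped (abs_sum_mul_le_of_damped_profiles)
open Summit.QuantumFields.BalabanUV.Beta.D1BFx.LatticeHLSProfiles (sum_pow_mul_exp_div_nrm_pow_free_scale_le summable_and_abs_tsum_le_of_abs_sum_le)
open Summit.QuantumFields.BalabanUV.Beta.D1BFx.NeedleHLSGain (abs_pairing_le_of_needle_left)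
open Summit.QuantumFields.BalabanUV.Beta.D1BFx.PairingByParts (pairing_grad_eq profile_shift_le supNorm_unitVec_le)
open Summit.QuantumFields.BalabanUV.Beta.D1BFx.NeedleNdlDipRowLetters (exp_rate_quarter)

/-! ## §1 A damped cubic profile times a bounded factor is absolutely summable -/

section Summable

variable {n : ℕ} {δ Bδ M : ℝ} {b : Site 4} {f g : Site 4 → ℝ}

/-- [folklore] **`ℓ¹` OF A DAMPED CUBIC PROFILE AT SCALE `n`**: `Σ_{x∈S} Bδ·e^{−(δ∕n)‖x−b‖}∕nrm(x−b)³ ≤ Bδ·(2·(1 + 216·(1 + 4∕δ)))·n` for every finite `S`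
(`sum_pow_mul_exp_div_nrm_pow_free_scale_le` at `p = 3`, `q = 0`). -/
theorem sum_dip_profile_le (hδ : 0 < δ) (hn : 1 ≤ n) (hB : 0 ≤ Bδ) (b : Site 4) (S : Finset (Site 4)) :
    ∑ x ∈ S, Bδ * Real.exp (-(δ / n) * Beta.PoissonInterior.supNorm (x - b)) / nrm (x - b) ^ 3
      ≤ Bδ * (2 * (1 + 2 * 4 * 3 ^ (4 - 1) * (1 + 4 / δ))) * n := by
  have h := sum_pow_mul_exp_div_nrm_pow_free_scale_le (d := 4) (by norm_num) hδ hn (p := 3) (by norm_num) 0 S b b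
  have e : ∑ x ∈ S, Bδ * Real.exp (-(δ / n) * Beta.PoissonInterior.supNorm (x - b)) / nrm (x - b) ^ 3
      = Bδ * ∑ x ∈ S, ((Beta.PoissonInterior.supNorm (x - b) : ℕ) : ℝ) ^ 0 * Real.exp (-(δ / n) * Beta.PoissonInterior.supNorm (x - b)) / nrm (x - b) ^ 3 := by
    rw [Finset.mul_sum]; exact Finset.sum_congr rfl fun x _ => by rw [pow_zero, one_mul]; ring
  rw [e, mul_assoc]
  refine mul_le_mul_of_nonneg_left (h.trans (le_of_eq ?_)) hB
  norm_num

/-- [folklore] **A DAMPED CUBIC PROFILE TIMES A BOUNDED FACTOR IS ABSOLUTELY SUMMABLE**, with `Σ' |f·g| ≤ Bδ·c_ℓ·n·M`. -/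
theorem summable_dip_mul_bdd (hδ : 0 < δ) (hn : 1 ≤ n) (hB : 0 ≤ Bδ)
    (hf : ∀ x : Site 4, |f x| ≤ Bδ * Real.exp (-(δ / n) * Beta.PoissonInterior.supNorm (x - b)) / nrm (x - b) ^ 3) (hg : ∀ x : Site 4, |g x| ≤ M) :
    Summable (fun x => f x * g x) ∧ |∑' x, f x * g x| ≤ Bδ * (2 * (1 + 2 * 4 * 3 ^ (4 - 1) * (1 + 4 / δ))) * n * M := by
  have hM : 0 ≤ M := (abs_nonneg _).trans (hg b)
  refine summable_and_abs_tsum_le_of_abs_sum_le fun S => ?_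
  calc ∑ x ∈ S, |f x * g x| ≤ ∑ x ∈ S, Bδ * Real.exp (-(δ / n) * Beta.PoissonInterior.supNorm (x - b)) / nrm (x - b) ^ 3 * M := by
        refine Finset.sum_le_sum fun x _ => ?_
        rw [abs_mul]
        exact mul_le_mul (hf x) (hg x) (abs_nonneg _) (by have := nrm_pos (x - b); positivity)
    _ = (∑ x ∈ S, Bδ * Real.exp (-(δ / n) * Beta.PoissonInterior.supNorm (x - b)) / nrm (x - b) ^ 3) * M := by rw [Finset.sum_mul]
    _ ≤ Bδ * (2 * (1 + 2 * 4 * 3 ^ (4 - 1) * (1 + 4 / δ))) * n * M := mul_le_mul_of_nonneg_right (sum_dip_profile_le hδ hn hB b S) hM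

end Summable

/-! ## §2 Needle-weighted exponent-2 differences of `Φ` (for `S4(δρ) = ⟨Ga∇row_u, ∇δρ_b⟩`) -/

section Needle

/-- [folklore] **BY PARTS AGAINST A DIPOLE VALUE PROFILE, NEEDLE-WEIGHTED DIFFERENCES**: let `Φ` be bounded with
`|Φ(x+e_i,α) − Φ(x,α)| ≤ KΦ′·Σ_{s∈N} q s·e^{−(δ∕n)‖x−ctr s‖}∕nrm(x−ctr s)²` (`q ≥ 0`) and `|f x| ≤ Bδ·e^{−(δ∕n)‖x−b‖}∕nrm(x−b)³`.  Then
`|⟨Φ, ∇f⟩| ≤ (4·(16·e^{δ}·C₄))·KΦ′·Bδ·Σ_{s∈N} q s·e^{−(δ∕4n)‖ctr s−b‖}∕nrm(ctr s − b)` (`pairing_grad_eq`; the backward difference is the forward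
one at `x − e_α`, profile shift `2²e^{δ}`; per needle site the damped pair (2,3) ↦ 1 with the n-free constant `C₄ = 4·2⁷·9³`). -/
theorem abs_pairing_grad_dip_le_of_needle_d1 {ι : Type*} (N : Finset ι) {q : ι → ℝ} (hq : ∀ s ∈ N, 0 ≤ q s) (ctr : ι → Site 4)
    {n : ℕ} (hn : 1 ≤ n) {δ KΦ' Bδ M : ℝ} (hδ : 0 < δ) (hK : 0 ≤ KΦ') (hB : 0 ≤ Bδ) {Φ : Site 4 → Fin 4 → ℝ} {f : Site 4 → ℝ} {b : Site 4}
    (hM : ∀ (x : Site 4) (α : Fin 4), |Φ x α| ≤ M)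
    (hΦ' : ∀ (x : Site 4) (α i : Fin 4), |Φ (x + unitVec i) α - Φ x α|
      ≤ KΦ' * ∑ s ∈ N, q s * (Real.exp (-(δ / n) * Beta.PoissonInterior.supNorm (x - ctr s)) / nrm (x - ctr s) ^ 2))
    (hf : ∀ x : Site 4, |f x| ≤ Bδ * Real.exp (-(δ / n) * Beta.PoissonInterior.supNorm (x - b)) / nrm (x - b) ^ 3) :
    |pairing Φ (grad f)| ≤ 4 * (16 * Real.exp δ * (4 * 2 ^ (4 + 3) * 9 ^ (4 - 1))) * KΦ' * Bδ *
      ∑ s ∈ N, q s * (Real.exp (-(δ / 4 / n) * Beta.PoissonInterior.supNorm (ctr s - b)) / nrm (ctr s - b)) := by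
  have hn0 : (0 : ℝ) < n := by exact_mod_cast hn
  set ε := δ / n with hε
  have hε0 : 0 < ε := div_pos hδ hn0
  have hεδ : ε ≤ δ := by
    rw [hε]; exact div_le_self hδ.le (by exact_mod_cast hn)
  set C₄ : ℝ := 4 * 2 ^ (4 + 3) * 9 ^ (4 - 1) with hC₄
  -- by parts: the two summabilities
  have h1 : ∀ a : Fin 4, Summable fun x : Site 4 => f x * Φ x a := fun a => (summable_dip_mul_bdd hδ hn hB hf (fun x => hM x a)).1
  have h2 : ∀ a : Fin 4, Summable fun x : Site 4 => f x * Φ (x - unitVec a) a := fun a =>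
    (summable_dip_mul_bdd hδ hn hB hf (fun x => hM (x - unitVec a) a)).1
  rw [pairing_comm, pairing_grad_eq f Φ h1 h2, pairing_comm]
  -- the backward differences carry the shifted exponent-2 needle profile
  have hD : ∀ (x : Site 4) (a : Fin 4), |Φ (x - unitVec a) a - Φ x a|
      ≤ ∑ s ∈ N, q s * (4 * Real.exp δ * KΦ' * Real.exp (-ε * Beta.PoissonInterior.supNorm (x - ctr s)) / nrm (x - ctr s) ^ 2) := by
    intro x a
    have h := hΦ' (x - unitVec a) a a
    rw [sub_add_cancel, abs_sub_comm] at h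
    refine h.trans ?_
    rw [Finset.mul_sum]
    refine Finset.sum_le_sum fun s hs => ?_
    have hsh := profile_shift_le hK hε0.le hεδ 2 (x - ctr s) (unitVec a) (supNorm_unitVec_le a).1
    have e1 : x - unitVec a - ctr s = x - ctr s - unitVec a := by abel
    rw [e1]
    calc KΦ' * (q s * (Real.exp (-ε * Beta.PoissonInterior.supNorm (x - ctr s - unitVec a)) / nrm (x - ctr s - unitVec a) ^ 2))
        = q s * (KΦ' * Real.exp (-ε * Beta.PoissonInterior.supNorm (x - ctr s - unitVec a)) / nrm (x - ctr s - unitVec a) ^ 2) := by ring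
      _ ≤ q s * (2 ^ 2 * Real.exp δ * KΦ' * Real.exp (-ε * Beta.PoissonInterior.supNorm (x - ctr s)) / nrm (x - ctr s) ^ 2) :=
          mul_le_mul_of_nonneg_left hsh (hq s hs)
      _ = _ := by norm_num
  have hfx : ∀ (x : Site 4) (_c : Fin 4), |f x| ≤ Bδ * Real.exp (-ε * Beta.PoissonInterior.supNorm (x - b)) / nrm (x - b) ^ 3 := fun x _ => by
    rw [hε]; exact hf x
  have h := abs_pairing_le_of_needle_left (F := Fin 4) N hq
    (g := fun s x => 4 * Real.exp δ * KΦ' * Real.exp (-ε * Beta.PoissonInterior.supNorm (x - ctr s)) / nrm (x - ctr s) ^ 2)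
    (h := fun x => Bδ * Real.exp (-ε * Beta.PoissonInterior.supNorm (x - b)) / nrm (x - b) ^ 3)
    (G := fun s => 4 * Real.exp δ * KΦ' * Bδ * C₄ * Real.exp (-ε * Beta.PoissonInterior.supNorm (ctr s - b)) / nrm (ctr s - b) ^ 1)
    hD hfx ?_
  · refine h.2.trans ?_
    have hcard : (Fintype.card (Fin 4) : ℝ) = 4 := by simp
    rw [hcard, Finset.mul_sum, Finset.mul_sum]
    refine Finset.sum_le_sum fun s hs => ?_
    have hns := nrm_pos (ctr s - b)
    have hexp : Real.exp (-ε * Beta.PoissonInterior.supNorm (ctr s - b)) ≤ Real.exp (-(δ / 4 / n) * Beta.PoissonInterior.supNorm (ctr s - b)) := by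
      rw [hε]; exact (exp_rate_quarter hδ.le hn0 _).1
    rw [pow_one]
    calc (4 : ℝ) * (q s * (4 * Real.exp δ * KΦ' * Bδ * C₄ * Real.exp (-ε * Beta.PoissonInterior.supNorm (ctr s - b)) / nrm (ctr s - b)))
        = 4 * (16 * Real.exp δ * C₄) * KΦ' * Bδ * (q s * (Real.exp (-ε * Beta.PoissonInterior.supNorm (ctr s - b)) / nrm (ctr s - b))) / 4 := by
          field_simp; ring
      _ ≤ 4 * (16 * Real.exp δ * C₄) * KΦ' * Bδ * (q s * (Real.exp (-(δ / 4 / n) * Beta.PoissonInterior.supNorm (ctr s - b)) / nrm (ctr s - b))) := by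
          have h0 : 0 ≤ 4 * (16 * Real.exp δ * C₄) * KΦ' * Bδ * (q s * (Real.exp (-(δ / 4 / n) * Beta.PoissonInterior.supNorm (ctr s - b)) / nrm (ctr s - b))) := by
            have := hq s hs; positivity
          have hle : 4 * (16 * Real.exp δ * C₄) * KΦ' * Bδ * (q s * (Real.exp (-ε * Beta.PoissonInterior.supNorm (ctr s - b)) / nrm (ctr s - b)))
              ≤ 4 * (16 * Real.exp δ * C₄) * KΦ' * Bδ * (q s * (Real.exp (-(δ / 4 / n) * Beta.PoissonInterior.supNorm (ctr s - b)) / nrm (ctr s - b))) :=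
            mul_le_mul_of_nonneg_left (mul_le_mul_of_nonneg_left (div_le_div_of_nonneg_right hexp hns.le) (hq s hs)) (by positivity)
          linarith
  · intro s _ S
    have h1 := abs_sum_mul_le_of_damped_profiles (d := 4) (by norm_num) (a := 2) (b := 3) (by norm_num) (by norm_num) (by norm_num)
      (by positivity : 0 ≤ 4 * Real.exp δ * KΦ') hB hε0.le S (ctr s) b
      (K := fun x => 4 * Real.exp δ * KΦ' * Real.exp (-ε * Beta.PoissonInterior.supNorm (x - ctr s)) / nrm (x - ctr s) ^ 2)
      (f := fun x => Bδ * Real.exp (-ε * Beta.PoissonInterior.supNorm (x - b)) / nrm (x - b) ^ 3)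
      (fun x _ => by rw [abs_of_nonneg (by have := nrm_pos (x - ctr s); positivity)])
      (fun x _ => by rw [abs_of_nonneg (by have := nrm_pos (x - b); positivity)])
    refine le_trans (le_of_eq ?_) (h1.trans (le_of_eq ?_))
    · exact Finset.sum_congr rfl fun x _ => by
        rw [abs_of_nonneg (mul_nonneg (by have := nrm_pos (x - ctr s); positivity) (by have := nrm_pos (x - b); positivity))]
    · rw [hC₄]; norm_num

end Needle

/-! ## §3 A flat sup of the differences of `Φ` (for `S2(δρ) = ⟨Ga∇C_u, ∇δρ_b⟩`) -/

section Flat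

/-- [folklore] **BY PARTS AGAINST A DIPOLE VALUE PROFILE, FLAT DIFFERENCES**: `Φ` bounded with `|Φ(x+e_i,α) − Φ(x,α)| ≤ KN′` and
`|f x| ≤ Bδ·e^{−(δ∕n)‖x−b‖}∕nrm(x−b)³` ⟹ `|⟨Φ, ∇f⟩| ≤ 4·KN′·Bδ·(2(1 + 216(1 + 4∕δ)))·n` (`pairing_grad_eq`, the `ℓ¹` bound of the profile). -/
theorem abs_pairing_grad_dip_le_of_flat_d1 {n : ℕ} (hn : 1 ≤ n) {δ KN' Bδ M : ℝ} (hδ : 0 < δ) (hB : 0 ≤ Bδ)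
    {Φ : Site 4 → Fin 4 → ℝ} {f : Site 4 → ℝ} {b : Site 4} (hM : ∀ (x : Site 4) (α : Fin 4), |Φ x α| ≤ M)
    (hΦ' : ∀ (x : Site 4) (α i : Fin 4), |Φ (x + unitVec i) α - Φ x α| ≤ KN')
    (hf : ∀ x : Site 4, |f x| ≤ Bδ * Real.exp (-(δ / n) * Beta.PoissonInterior.supNorm (x - b)) / nrm (x - b) ^ 3) :
    |pairing Φ (grad f)| ≤ 4 * KN' * Bδ * (2 * (1 + 2 * 4 * 3 ^ (4 - 1) * (1 + 4 / δ))) * n := by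
  have hKN : 0 ≤ KN' := (abs_nonneg _).trans (hΦ' b 0 0)
  have h1 : ∀ a : Fin 4, Summable fun x : Site 4 => f x * Φ x a := fun a => (summable_dip_mul_bdd hδ hn hB hf (fun x => hM x a)).1
  have h2 : ∀ a : Fin 4, Summable fun x : Site 4 => f x * Φ (x - unitVec a) a := fun a =>
    (summable_dip_mul_bdd hδ hn hB hf (fun x => hM (x - unitVec a) a)).1
  rw [pairing_comm, pairing_grad_eq f Φ h1 h2, pairing_def]
  have hD : ∀ (x : Site 4) (a : Fin 4), |Φ (x - unitVec a) a - Φ x a| ≤ KN' := by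
    intro x a
    have h := hΦ' (x - unitVec a) a a
    rwa [sub_add_cancel, abs_sub_comm] at h
  -- fibrewise: `Σ_a f(x)·D_a(x)`, `|…| ≤ 4·KN'·|f x|`-profile
  have hfib : ∀ x : Site 4, |∑ a : Fin 4, f x * (Φ (x - unitVec a) a - Φ x a)|
      ≤ (4 * KN' * Bδ) * Real.exp (-(δ / n) * Beta.PoissonInterior.supNorm (x - b)) / nrm (x - b) ^ 3 := by
    intro x
    have hnx := nrm_pos (x - b)
    calc |∑ a : Fin 4, f x * (Φ (x - unitVec a) a - Φ x a)| ≤ ∑ a : Fin 4, |f x * (Φ (x - unitVec a) a - Φ x a)| := Finset.abs_sum_le_sum_abs _ _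
      _ ≤ ∑ _a : Fin 4, Bδ * Real.exp (-(δ / n) * Beta.PoissonInterior.supNorm (x - b)) / nrm (x - b) ^ 3 * KN' := by
          refine Finset.sum_le_sum fun a _ => ?_
          rw [abs_mul]; exact mul_le_mul (hf x) (hD x a) (abs_nonneg _) (by positivity)
      _ = (4 * KN' * Bδ) * Real.exp (-(δ / n) * Beta.PoissonInterior.supNorm (x - b)) / nrm (x - b) ^ 3 := by
          simp only [Finset.sum_const, Finset.card_univ, Fintype.card_fin]; ring
  have h := summable_and_abs_tsum_le_of_abs_sum_le (h := fun x => ∑ a : Fin 4, f x * (Φ (x - unitVec a) a - Φ x a))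
    (C := (4 * KN' * Bδ) * (2 * (1 + 2 * 4 * 3 ^ (4 - 1) * (1 + 4 / δ))) * n) fun S =>
      (Finset.sum_le_sum fun x _ => hfib x).trans (sum_dip_profile_le hδ hn (by positivity) b S)
  exact h.2.trans (le_of_eq (by ring))

end Flat

end Summit.QuantumFields.BalabanUV.Beta.D1BFx.NeedleNdlDipByParts

end
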